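import Summits.Ventures.PercRepro.C025ProfileThinTriangleB

/-!
# THE ROW `(q, q+1)` ON THIN MATROIDS WITH A 3-CIRCUIT — part C: (Cap) (night-3 g15)
`proofs/NIGHT3-G14-SIZE.md` §5e; parts A (structure) and B ((Dem)). The capacity side of the HYBRID RULE for an ABSTRACT weight
`w`: a rank-`(q+1)` set `S` has `q + 1` points (independent: the loaders are the `q`-sets `S ∖ {c}`, paying their `K`-type weight
exactly as in 𝒞(q) — `cap_succ`, the load is `(q+1) z_F`, `z_J + q g_J` or `2 g_I + (q−1) s_I`), or `q + 2` points containing `K`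
(`cap_Q`: the `(q+1)`-loaders are the `q − 1` sets `S ∖ {c}`, `c ∉ K`, paying `≤ 1`; the `q`-loaders with two points of `K` — at most
`3(q−1)` — pay `s_Q`; those with `≤ 1` point of `K` have no inner point inside `S` and pay `0`), or `q + 2` points not containing `K`
(`cap_extra`: at most two coloops, so at most two `(q+1)`-loaders paying `≤ 1`, and the σ-loaders inject into `col S × (S ∖ col S)`,
at most `c (q + 2 − c) ≤ 2q` of them paying `σ` each: load `≤ 2 + 2qσ ≤ 14/3 < q + 1` for `q ≥ 4` and `2qσ ≤ 8/3`), or `≥ q + 3` points (`cap_big`).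
-/
open scoped Matroid
namespace PercRepro
open Set Finset ThmH Staged
namespace ThinTriangle
variable {α : Type} [DecidableEq α] {M : Matroid α} [M.Finite]

/-- **(Cap), `|S| = q + 1`**: the loaders are the sets `S ∖ {c}`, `c ∈ S`; the load is `(q+1) z_F`, `z_J + q g_J` or
`2 g_I + (q−1) s_I` according to `|S ∩ K| = 0, 1, 2` (`K ⊄ S` since `ρ(S) = q + 1 = |S|`). -/
theorem cap_succ {q : ℕ} {K : Finset α} (hK3 : K.card = 3) (hKrk : rkN M K = 2)
    (w : Finset α → Finset α → ℚ) (hw_nonneg : ∀ B S, 0 ≤ w B S) (sI gI gJ zJ zF : ℚ)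
    (hw_2I : ∀ B S : Finset α, B.card = q → (B ∩ K).card = 2 → S.card = q + 1 → w B S = sI)
    (hw_GI : ∀ B S : Finset α, B.card = q → (B ∩ K).card = 1 → S.card = q + 1 → (S ∩ K).card = 2 → w B S = gI)
    (hw_GJ : ∀ B S : Finset α, B.card = q → (B ∩ K).card = 1 → S.card = q + 1 → (S ∩ K).card = 1 → w B S = gJ)
    (hw_ZJ : ∀ B S : Finset α, B.card = q → (B ∩ K).card = 0 → S.card = q + 1 → (S ∩ K).card = 1 → w B S = zJ)
    (hw_ZF : ∀ B S : Finset α, B.card = q → (B ∩ K).card = 0 → S.card = q + 1 → (S ∩ K).card = 0 → w B S = zF)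
    (hcapF : ((q : ℚ) + 1) * zF ≤ q + 1) (hcapJ : zJ + (q : ℚ) * gJ ≤ q + 1)
    (hcapI : 2 * gI + ((q : ℚ) - 1) * sI ≤ q + 1) (hq : 1 ≤ q)
    {S : Finset α} (hSc : S.card = q + 1) (hS : rkN M S = q + 1) :
    ∑ B ∈ (Profile.Rq M q).filter (fun B => B ⊆ S), w B S ≤ (q : ℚ) + 1 := by
  have hKS : ¬ K ⊆ S := fun h => by have := OneCircuit.rkN_add_one_le_card_of_subset hK3 hKrk h; omega
  have hsub : (Profile.Rq M q).filter (fun B => B ⊆ S) ⊆ S.image (fun c => S.erase c) := by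
    intro B hB
    rw [Finset.mem_filter, Profile.mem_Rq] at hB
    obtain ⟨⟨_, hBr⟩, hBS⟩ := hB
    have hBq : rkN M B = q := rkN_eq_iff.mpr hBr
    have hBc : B.card = q := by
      have h1 : q ≤ B.card := hBq ▸ rkN_le_card B
      have h2 : B.card ≤ q + 1 := hSc ▸ Finset.card_le_card hBS
      rcases Nat.lt_or_ge B.card (q + 1) with hlt | hge
      · omega
      · exfalso
        have : B = S := Finset.eq_of_subset_of_card_le hBS (by omega)
        rw [this] at hBq
        omega
    exact OneCircuit.powersetCard_pred_subset_image hSc (Finset.mem_powersetCard.mpr ⟨hBS, hBc⟩)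
  have hsum : ∑ B ∈ (Profile.Rq M q).filter (fun B => B ⊆ S), w B S ≤ ∑ c ∈ S, w (S.erase c) S :=
    (Finset.sum_le_sum_of_subset_of_nonneg hsub (fun B _ _ => hw_nonneg B S)).trans
      (le_of_eq (Finset.sum_image (Finset.erase_injOn S)))
  have hm : (S ∩ K).card ≤ 3 := (Finset.card_le_card Finset.inter_subset_right).trans hK3.le
  have hm3 : (S ∩ K).card ≠ 3 := fun h => hKS ((OneCircuit.subset_iff_card_inter_eq hK3).mpr h)
  have hce : ∀ c ∈ S, (S.erase c).card = q := fun c hc => by rw [Finset.card_erase_of_mem hc, hSc]; omega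
  have hSK : (S \ K).card + (S ∩ K).card = S.card := Finset.card_sdiff_add_card_inter S K
  rcases (by omega : (S ∩ K).card = 0 ∨ (S ∩ K).card = 1 ∨ (S ∩ K).card = 2) with h0 | h1 | h2
  · -- free
    have heval : ∀ c ∈ S, w (S.erase c) S = zF := by
      intro c hc
      have hi := OneCircuit.card_erase_inter S K hc
      have hcK : c ∉ K := by
        intro hcK
        have : c ∈ S ∩ K := Finset.mem_inter.mpr ⟨hc, hcK⟩
        rw [Finset.card_eq_zero] at h0
        rw [h0] at this
        exact Finset.notMem_empty _ this
      rw [if_neg hcK, h0] at hi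
      exact hw_ZF _ _ (hce c hc) hi hSc h0
    rw [Finset.sum_congr rfl heval, Finset.sum_const, nsmul_eq_mul, hSc] at hsum
    push_cast at hsum
    linarith
  · -- J
    have heval : ∀ c ∈ S, w (S.erase c) S = if c ∈ K then zJ else gJ := by
      intro c hc
      have hi := OneCircuit.card_erase_inter S K hc
      split_ifs with hcK
      · rw [if_pos hcK, h1] at hi; exact hw_ZJ _ _ (hce c hc) hi hSc h1
      · rw [if_neg hcK, h1] at hi; exact hw_GJ _ _ (hce c hc) hi hSc h1
    rw [Finset.sum_congr rfl heval, OneCircuit.sum_ite_mem_eq, h1] at hsum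
    have hq' : (S \ K).card = q := by omega
    rw [hq'] at hsum
    push_cast at hsum
    linarith
  · -- I
    have heval : ∀ c ∈ S, w (S.erase c) S = if c ∈ K then gI else sI := by
      intro c hc
      have hi := OneCircuit.card_erase_inter S K hc
      split_ifs with hcK
      · rw [if_pos hcK, h2] at hi; exact hw_GI _ _ (hce c hc) hi hSc h2
      · rw [if_neg hcK, h2] at hi; exact hw_2I _ _ (hce c hc) hi hSc
    rw [Finset.sum_congr rfl heval, OneCircuit.sum_ite_mem_eq, h2] at hsum
    have hq' : (S \ K).card = q - 1 := by omega
    rw [hq', Nat.cast_sub hq] at hsum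
    push_cast at hsum
    linarith

/-- **(Cap), `|S| = q + 2`, `K ⊆ S`**: the `(q+1)`-loaders are the `q − 1` sets `S ∖ {c}`, `c ∉ K` (`≤ 1` each); the `q`-loaders with
two points of `K` (at most `3 (q − 1)`, the sets `S ∖ {k, c}`) pay `s_Q`; a `q`-loader with `≤ 1` point of `K` has no inner point in `S`
(its two missing points are in `K`, and `S ∖ {c}` has rank `q + 1` for `c ∈ K`) and pays `0`; the load is `≤ (q − 1) + 3 (q − 1) s_Q`. -/
theorem cap_Q {q : ℕ} (hsimple : ∀ X ⊆ gr M, X.card ≤ 2 → rkN M X = X.card)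
    (hthin : ∀ X ⊆ gr M, rkN M X = q → X.card ≤ q + 1)
    {K : Finset α} (hKg : K ⊆ gr M) (hK3 : K.card = 3) (hKrk : rkN M K = 2)
    (w : Finset α → Finset α → ℚ) (sQ σ : ℚ) (hsQ : 0 ≤ sQ)
    (hw_a1 : ∀ B S : Finset α, B.card = q + 1 → S.card = q + 2 → w B S ≤ 1)
    (hw_2Q : ∀ B S : Finset α, B.card = q → (B ∩ K).card = 2 → S.card = q + 2 → (S ∩ K).card = 3 → w B S = sQ)
    (hw_q_small : ∀ B S : Finset α, B.card = q → (B ∩ K).card ≤ 1 → S.card = q + 2 →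
      w B S ≤ if (∃ y ∈ S \ B, rkN M (insert y B) = q) then σ else 0)
    (hcapQ : ((q : ℚ) - 1) + 3 * ((q : ℚ) - 1) * sQ ≤ q + 1) (hq : 1 ≤ q)
    {S : Finset α} (hSc : S.card = q + 2) (hS : rkN M S = q + 1) (hKS : K ⊆ S) :
    ∑ B ∈ (Profile.Rq M q).filter (fun B => B ⊆ S), w B S ≤ (q : ℚ) + 1 := by
  have hSK : (S ∩ K).card = 3 := (OneCircuit.subset_iff_card_inter_eq hK3).mp hKS
  have hSdK : (S \ K).card = q - 1 := by rw [Finset.card_sdiff_of_subset hKS, hSc, hK3]; omega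
  -- the pointwise bound on the loaders
  have hpt : ∀ B ∈ (Profile.Rq M q).filter (fun B => B ⊆ S),
      w B S ≤ (if B.card = q + 1 then (1 : ℚ) else 0) + (if B.card = q ∧ (B ∩ K).card = 2 then sQ else 0) := by
    intro B hB
    rw [Finset.mem_filter, Profile.mem_Rq] at hB
    obtain ⟨⟨hBg, hBr⟩, hBS⟩ := hB
    have hBq : rkN M B = q := rkN_eq_iff.mpr hBr
    rcases card_eq_or_eq_of_rkN_eq hthin hBg hBq with hBc | hBc
    · rw [if_neg (by omega)]
      have hm : (B ∩ K).card ≤ 3 := (Finset.card_le_card Finset.inter_subset_right).trans hK3.le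
      rcases (by omega : (B ∩ K).card ≤ 1 ∨ (B ∩ K).card = 2 ∨ (B ∩ K).card = 3) with h1 | h2 | h3
      · rw [if_neg (by omega)]
        have hw := hw_q_small B S hBc h1 hSc
        rw [if_neg ?_] at hw
        · linarith
        · rintro ⟨y, hy, hyr⟩
          have hySB := Finset.mem_sdiff.mp hy
          have hSB : (S \ B).card = 2 := by rw [Finset.card_sdiff_of_subset hBS]; omega
          have hKBsub : K \ B ⊆ S \ B := fun z hz =>
            Finset.mem_sdiff.mpr ⟨hKS (Finset.mem_sdiff.mp hz).1, (Finset.mem_sdiff.mp hz).2⟩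
          have hKB : (K \ B).card + (B ∩ K).card = 3 := by
            have := OneCircuit.card_sdiff_add_card_inter' K B; omega
          have hKBc : (K \ B).card = 2 := by have := Finset.card_le_card hKBsub; omega
          have hEq : K \ B = S \ B := Finset.eq_of_subset_of_card_le hKBsub (by omega)
          have hc1 : ((S \ B).erase y).card = 1 := by rw [Finset.card_erase_of_mem hy, hSB]
          obtain ⟨c, hc⟩ := Finset.card_eq_one.mp hc1
          have hcmem : c ∈ (S \ B).erase y := hc ▸ Finset.mem_singleton_self c
          have hcS : c ∈ S := (Finset.mem_sdiff.mp (Finset.mem_of_mem_erase hcmem)).1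
          have hcB : c ∉ B := (Finset.mem_sdiff.mp (Finset.mem_of_mem_erase hcmem)).2
          have hcK : c ∈ K := by
            have : c ∈ K \ B := hEq ▸ Finset.mem_sdiff.mpr ⟨hcS, hcB⟩
            exact (Finset.mem_sdiff.mp this).1
          have hSc' : S.erase c = insert y B := by
            apply Finset.eq_of_subset_of_card_le
            · intro z hz
              rw [Finset.mem_erase] at hz
              rw [Finset.mem_insert]
              by_cases hzB : z ∈ B
              · right; exact hzB
              · left
                by_contra hzy
                have : z ∈ (S \ B).erase y := Finset.mem_erase.mpr ⟨hzy, Finset.mem_sdiff.mpr ⟨hz.2, hzB⟩⟩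
                rw [hc, Finset.mem_singleton] at this
                exact hz.1 this
            · have := Finset.card_erase_of_mem hcS
              rw [Finset.card_insert_of_notMem hySB.2]
              omega
          have := rkN_erase_eq_succ_of_mem hsimple hKg hK3 hKrk hKS hS hcK
          rw [hSc', hyr] at this
          omega
      · rw [if_pos ⟨hBc, h2⟩, hw_2Q B S hBc h2 hSc hSK]
        simp
      · exfalso
        have hKB : K ⊆ B := (OneCircuit.subset_iff_card_inter_eq hK3).mpr h3
        have := OneCircuit.rkN_add_one_le_card_of_subset hK3 hKrk hKB
        omega
    · rw [if_pos hBc, if_neg (by omega)]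
      have := hw_a1 B S hBc hSc
      linarith
  have hsum := Finset.sum_le_sum hpt
  rw [Finset.sum_add_distrib] at hsum
  -- the `(q+1)`-loaders: at most `q − 1` of them
  have hA : ∑ B ∈ (Profile.Rq M q).filter (fun B => B ⊆ S), (if B.card = q + 1 then (1 : ℚ) else 0) ≤
      (q : ℚ) - 1 := by
    rw [Finset.sum_ite, Finset.sum_const_zero, add_zero, Finset.sum_const, nsmul_eq_mul, mul_one]
    have himg : ((Profile.Rq M q).filter (fun B => B ⊆ S)).filter (fun B => B.card = q + 1) ⊆
        (S \ K).image (fun c => S.erase c) := by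
      intro B hB
      rw [Finset.mem_filter, Finset.mem_filter, Profile.mem_Rq] at hB
      obtain ⟨⟨⟨_, hBr⟩, hBS⟩, hBc⟩ := hB
      have hBq : rkN M B = q := rkN_eq_iff.mpr hBr
      have hSB : (S \ B).card = 1 := by rw [Finset.card_sdiff_of_subset hBS]; omega
      obtain ⟨c, hc⟩ := Finset.card_eq_one.mp hSB
      have hcmem : c ∈ S \ B := hc ▸ Finset.mem_singleton_self c
      have hcS : c ∈ S := (Finset.mem_sdiff.mp hcmem).1
      have hcB : c ∉ B := (Finset.mem_sdiff.mp hcmem).2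
      have hBeq : B = S.erase c := by
        apply Finset.eq_of_subset_of_card_le
        · intro z hz; exact Finset.mem_erase.mpr ⟨fun h => hcB (h ▸ hz), hBS hz⟩
        · have := Finset.card_erase_of_mem hcS; omega
      have hcK : c ∉ K := by
        intro hcK
        have := rkN_erase_eq_succ_of_mem hsimple hKg hK3 hKrk hKS hS hcK
        rw [← hBeq] at this
        omega
      rw [Finset.mem_image]
      exact ⟨c, Finset.mem_sdiff.mpr ⟨hcS, hcK⟩, hBeq.symm⟩
    have h1 := Finset.card_le_card himg
    have h2 : ((S \ K).image (fun c => S.erase c)).card ≤ (S \ K).card := Finset.card_image_le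
    have h3 : (((Profile.Rq M q).filter (fun B => B ⊆ S)).filter (fun B => B.card = q + 1)).card ≤ q - 1 := by
      omega
    have h4 : ((((Profile.Rq M q).filter (fun B => B ⊆ S)).filter (fun B => B.card = q + 1)).card : ℚ) ≤
        ((q - 1 : ℕ) : ℚ) := by exact_mod_cast h3
    rw [Nat.cast_sub hq] at h4
    push_cast at h4
    linarith
  -- the `2K`-loaders: at most `3 (q − 1)` of them
  have hB2 : ∑ B ∈ (Profile.Rq M q).filter (fun B => B ⊆ S),
      (if B.card = q ∧ (B ∩ K).card = 2 then sQ else 0) ≤ 3 * ((q : ℚ) - 1) * sQ := by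
    rw [Finset.sum_ite, Finset.sum_const_zero, add_zero, Finset.sum_const, nsmul_eq_mul]
    have hcount : (((Profile.Rq M q).filter (fun B => B ⊆ S)).filter
        (fun B => B.card = q ∧ (B ∩ K).card = 2)).card ≤ 3 * (q - 1) := by
      have himg : ((Profile.Rq M q).filter (fun B => B ⊆ S)).filter (fun B => B.card = q ∧ (B ∩ K).card = 2) ⊆
          (K ×ˢ (S \ K)).image (fun p => (S.erase p.1).erase p.2) := by
        intro B hB
        rw [Finset.mem_filter, Finset.mem_filter] at hB
        obtain ⟨⟨_, hBS⟩, hBc, hB2⟩ := hB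
        have hKB : (K \ B).card = 1 := by have := OneCircuit.card_sdiff_add_card_inter' K B; omega
        obtain ⟨k, hk⟩ := Finset.card_eq_one.mp hKB
        have hkK : k ∈ K := (Finset.mem_sdiff.mp (hk ▸ Finset.mem_singleton_self k)).1
        have hkB : k ∉ B := (Finset.mem_sdiff.mp (hk ▸ Finset.mem_singleton_self k)).2
        have hSB : (S \ B).card = 2 := by rw [Finset.card_sdiff_of_subset hBS]; omega
        have hSBK : ((S \ B) ∩ K).card = 1 := by
          have heq : (S \ B) ∩ K = K \ B := by
            ext x
            simp only [Finset.mem_inter, Finset.mem_sdiff]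
            constructor
            · rintro ⟨⟨_, hxB⟩, hxK⟩; exact ⟨hxK, hxB⟩
            · rintro ⟨hxK, hxB⟩; exact ⟨⟨hKS hxK, hxB⟩, hxK⟩
          rw [heq, hKB]
        have hSBK' : ((S \ B) \ K).card = 1 := by have := Finset.card_sdiff_add_card_inter (S \ B) K; omega
        obtain ⟨c, hc⟩ := Finset.card_eq_one.mp hSBK'
        have hcmem : c ∈ (S \ B) \ K := hc ▸ Finset.mem_singleton_self c
        have hcS : c ∈ S := (Finset.mem_sdiff.mp (Finset.mem_sdiff.mp hcmem).1).1
        have hcB : c ∉ B := (Finset.mem_sdiff.mp (Finset.mem_sdiff.mp hcmem).1).2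
        have hcK : c ∉ K := (Finset.mem_sdiff.mp hcmem).2
        have hkc : k ≠ c := fun h => hcK (h ▸ hkK)
        have hpair : S \ B = {k, c} := by
          symm
          apply Finset.eq_of_subset_of_card_le
          · intro x hx
            rw [Finset.mem_insert, Finset.mem_singleton] at hx
            rcases hx with rfl | rfl
            · exact Finset.mem_sdiff.mpr ⟨hKS hkK, hkB⟩
            · exact Finset.mem_sdiff.mpr ⟨hcS, hcB⟩
          · rw [Finset.card_pair hkc]; omega
        rw [Finset.mem_image]
        refine ⟨(k, c), Finset.mem_product.mpr ⟨hkK, Finset.mem_sdiff.mpr ⟨hcS, hcK⟩⟩, ?_⟩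
        apply Finset.eq_of_subset_of_card_le
        · intro x hx
          rw [Finset.mem_erase, Finset.mem_erase] at hx
          by_contra hxB
          have : x ∈ S \ B := Finset.mem_sdiff.mpr ⟨hx.2.2, hxB⟩
          rw [hpair, Finset.mem_insert, Finset.mem_singleton] at this
          rcases this with h | h
          · exact hx.2.1 h
          · exact hx.1 h
        · rw [Finset.card_erase_of_mem (Finset.mem_erase.mpr ⟨hkc.symm, hcS⟩),
            Finset.card_erase_of_mem (hKS hkK), hSc, hBc]
          omega
      calc (((Profile.Rq M q).filter (fun B => B ⊆ S)).filter (fun B => B.card = q ∧ (B ∩ K).card = 2)).card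
          ≤ ((K ×ˢ (S \ K)).image (fun p => (S.erase p.1).erase p.2)).card := Finset.card_le_card himg
        _ ≤ (K ×ˢ (S \ K)).card := Finset.card_image_le
        _ = 3 * (q - 1) := by rw [Finset.card_product, hK3, hSdK]
    have hcount' : ((((Profile.Rq M q).filter (fun B => B ⊆ S)).filter
        (fun B => B.card = q ∧ (B ∩ K).card = 2)).card : ℚ) ≤ 3 * ((q : ℚ) - 1) := by
      have : ((((Profile.Rq M q).filter (fun B => B ⊆ S)).filter
          (fun B => B.card = q ∧ (B ∩ K).card = 2)).card : ℚ) ≤ ((3 * (q - 1) : ℕ) : ℚ) := by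
        exact_mod_cast hcount
      rw [Nat.cast_mul, Nat.cast_sub hq] at this
      push_cast at this
      linarith
    exact mul_le_mul_of_nonneg_right hcount' hsQ
  linarith

/-- **(Cap), `|S| = q + 2`, `K ⊄ S`**: with `c = |col S| ≤ 2` coloops (`card_col_le_two`), the `(q+1)`-loaders are the sets `S ∖ {x}`,
`x ∈ col S` (`≤ 1` each), the `2K`-loaders pay `0` (`|S ∩ K| ≠ 3`), and the σ-loaders inject into `col S × (S ∖ col S)`
(`mem_image_of_inner`): load `≤ c + c (q + 2 − c) σ ≤ 2 + 2 q σ ≤ 2 + 8/3 < 5 ≤ q + 1`. -/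
theorem cap_extra {q : ℕ} (hsimple : ∀ X ⊆ gr M, X.card ≤ 2 → rkN M X = X.card)
    (hthin : ∀ X ⊆ gr M, rkN M X = q → X.card ≤ q + 1)
    {K : Finset α} (hKg : K ⊆ gr M) (hK3 : K.card = 3) (hKrk : rkN M K = 2)
    (w : Finset α → Finset α → ℚ) (σ : ℚ) (hσ : 0 ≤ σ) (h2q : 2 * (q : ℚ) * σ ≤ 8 / 3) (hq4 : 4 ≤ q)
    (hw_a1 : ∀ B S : Finset α, B.card = q + 1 → S.card = q + 2 → w B S ≤ 1)
    (hw_2Q0 : ∀ B S : Finset α, B.card = q → (B ∩ K).card = 2 → S.card = q + 2 → (S ∩ K).card ≠ 3 → w B S = 0)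
    (hw_q_small : ∀ B S : Finset α, B.card = q → (B ∩ K).card ≤ 1 → S.card = q + 2 →
      w B S ≤ if (∃ y ∈ S \ B, rkN M (insert y B) = q) then σ else 0)
    {S : Finset α} (hSg : S ⊆ gr M) (hSc : S.card = q + 2) (hS : rkN M S = q + 1) (hKS : ¬ K ⊆ S) :
    ∑ B ∈ (Profile.Rq M q).filter (fun B => B ⊆ S), w B S ≤ (q : ℚ) + 1 := by
  have hSK3 : (S ∩ K).card ≠ 3 := fun h => hKS ((OneCircuit.subset_iff_card_inter_eq hK3).mpr h)
  have hcol2 : (S.filter (fun c => rkN M (S.erase c) = q)).card ≤ 2 :=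
    card_col_le_two hsimple hthin hKg hK3 hKrk hSg hSc hS hKS
  have hcolS : S.filter (fun c => rkN M (S.erase c) = q) ⊆ S := Finset.filter_subset _ _
  have hScol : (S \ S.filter (fun c => rkN M (S.erase c) = q)).card =
      q + 2 - (S.filter (fun c => rkN M (S.erase c) = q)).card := by
    rw [Finset.card_sdiff_of_subset hcolS, hSc]
  -- the pointwise bound on the loaders
  have hpt : ∀ B ∈ (Profile.Rq M q).filter (fun B => B ⊆ S),
      w B S ≤ (if B.card = q + 1 then (1 : ℚ) else 0) +
        (if (B.card = q ∧ ∃ y ∈ S \ B, rkN M (insert y B) = q) then σ else 0) := by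
    intro B hB
    rw [Finset.mem_filter, Profile.mem_Rq] at hB
    obtain ⟨⟨hBg, hBr⟩, hBS⟩ := hB
    have hBq : rkN M B = q := rkN_eq_iff.mpr hBr
    rcases card_eq_or_eq_of_rkN_eq hthin hBg hBq with hBc | hBc
    · rw [if_neg (by omega)]
      have hm : (B ∩ K).card ≤ 3 := (Finset.card_le_card Finset.inter_subset_right).trans hK3.le
      rcases (by omega : (B ∩ K).card ≤ 1 ∨ (B ∩ K).card = 2 ∨ (B ∩ K).card = 3) with h1 | h2 | h3
      · have hw := hw_q_small B S hBc h1 hSc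
        by_cases hex : ∃ y ∈ S \ B, rkN M (insert y B) = q
        · rw [if_pos hex] at hw
          rw [if_pos ⟨hBc, hex⟩]
          linarith
        · rw [if_neg hex] at hw
          rw [if_neg (fun h => hex h.2)]
          linarith
      · rw [hw_2Q0 B S hBc h2 hSc hSK3]
        split_ifs <;> linarith
      · exfalso
        have hKB : K ⊆ B := (OneCircuit.subset_iff_card_inter_eq hK3).mpr h3
        have := OneCircuit.rkN_add_one_le_card_of_subset hK3 hKrk hKB
        omega
    · rw [if_pos hBc, if_neg (by omega)]
      have := hw_a1 B S hBc hSc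
      linarith
  have hsum := Finset.sum_le_sum hpt
  rw [Finset.sum_add_distrib] at hsum
  -- the `(q+1)`-loaders are the sets `S ∖ {c}` with `c ∈ col S`
  have hA : ∑ B ∈ (Profile.Rq M q).filter (fun B => B ⊆ S), (if B.card = q + 1 then (1 : ℚ) else 0) ≤
      ((S.filter (fun c => rkN M (S.erase c) = q)).card : ℚ) := by
    rw [Finset.sum_ite, Finset.sum_const_zero, add_zero, Finset.sum_const, nsmul_eq_mul, mul_one]
    have himg : ((Profile.Rq M q).filter (fun B => B ⊆ S)).filter (fun B => B.card = q + 1) ⊆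
        (S.filter (fun c => rkN M (S.erase c) = q)).image (fun c => S.erase c) := by
      intro B hB
      rw [Finset.mem_filter, Finset.mem_filter, Profile.mem_Rq] at hB
      obtain ⟨⟨⟨_, hBr⟩, hBS⟩, hBc⟩ := hB
      have hBq : rkN M B = q := rkN_eq_iff.mpr hBr
      have hSB : (S \ B).card = 1 := by rw [Finset.card_sdiff_of_subset hBS]; omega
      obtain ⟨c, hc⟩ := Finset.card_eq_one.mp hSB
      have hcmem : c ∈ S \ B := hc ▸ Finset.mem_singleton_self c
      have hcS : c ∈ S := (Finset.mem_sdiff.mp hcmem).1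
      have hcB : c ∉ B := (Finset.mem_sdiff.mp hcmem).2
      have hBeq : B = S.erase c := by
        apply Finset.eq_of_subset_of_card_le
        · intro z hz; exact Finset.mem_erase.mpr ⟨fun h => hcB (h ▸ hz), hBS hz⟩
        · have := Finset.card_erase_of_mem hcS; omega
      rw [Finset.mem_image]
      exact ⟨c, Finset.mem_filter.mpr ⟨hcS, by rw [← hBeq]; exact hBq⟩, hBeq.symm⟩
    have h1 := Finset.card_le_card himg
    have h2 : ((S.filter (fun c => rkN M (S.erase c) = q)).image (fun c => S.erase c)).card ≤
        (S.filter (fun c => rkN M (S.erase c) = q)).card := Finset.card_image_le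
    exact_mod_cast h1.trans h2
  -- the σ-loaders inject into `col S × (S ∖ col S)`
  have hB2 : ∑ B ∈ (Profile.Rq M q).filter (fun B => B ⊆ S),
      (if (B.card = q ∧ ∃ y ∈ S \ B, rkN M (insert y B) = q) then σ else 0) ≤
      (((S.filter (fun c => rkN M (S.erase c) = q)).card *
        (q + 2 - (S.filter (fun c => rkN M (S.erase c) = q)).card) : ℕ) : ℚ) * σ := by
    rw [Finset.sum_ite, Finset.sum_const_zero, add_zero, Finset.sum_const, nsmul_eq_mul]
    apply mul_le_mul_of_nonneg_right _ hσ
    have himg : ((Profile.Rq M q).filter (fun B => B ⊆ S)).filter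
        (fun B => B.card = q ∧ ∃ y ∈ S \ B, rkN M (insert y B) = q) ⊆
        ((S.filter (fun c => rkN M (S.erase c) = q)) ×ˢ (S \ S.filter (fun c => rkN M (S.erase c) = q))).image
          (fun p => (S.erase p.1).erase p.2) := by
      intro B hB
      rw [Finset.mem_filter, Finset.mem_filter, Profile.mem_Rq] at hB
      obtain ⟨⟨⟨_, hBr⟩, hBS⟩, hBc, y, hy, hyr⟩ := hB
      have hBq : rkN M B = q := rkN_eq_iff.mpr hBr
      exact mem_image_of_inner hSc hS hBS hBc hBq (Finset.mem_sdiff.mp hy).1 (Finset.mem_sdiff.mp hy).2 hyr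
    have h1 := Finset.card_le_card himg
    have h2 := Finset.card_image_le (s := (S.filter (fun c => rkN M (S.erase c) = q)) ×ˢ
      (S \ S.filter (fun c => rkN M (S.erase c) = q))) (f := fun p : α × α => (S.erase p.1).erase p.2)
    rw [Finset.card_product, hScol] at h2
    exact_mod_cast h1.trans h2
  -- arithmetic: `c + c (q + 2 − c) σ ≤ 2 + 2 q σ ≤ 2 + 8/3 < 5 ≤ q + 1`
  have hc2q : (S.filter (fun c => rkN M (S.erase c) = q)).card *
      (q + 2 - (S.filter (fun c => rkN M (S.erase c) = q)).card) ≤ 2 * q := by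
    rcases (by omega : (S.filter (fun c => rkN M (S.erase c) = q)).card = 0 ∨
      (S.filter (fun c => rkN M (S.erase c) = q)).card = 1 ∨
      (S.filter (fun c => rkN M (S.erase c) = q)).card = 2) with h | h | h <;> rw [h] <;> omega
  have hc2q' : (((S.filter (fun c => rkN M (S.erase c) = q)).card *
      (q + 2 - (S.filter (fun c => rkN M (S.erase c) = q)).card) : ℕ) : ℚ) ≤ 2 * (q : ℚ) := by
    exact_mod_cast hc2q
  have hcol2' : ((S.filter (fun c => rkN M (S.erase c) = q)).card : ℚ) ≤ 2 := by exact_mod_cast hcol2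
  have hq4' : (4 : ℚ) ≤ q := by exact_mod_cast hq4
  have := mul_le_mul_of_nonneg_right hc2q' hσ
  linarith

/-- **(Cap), `|S| ≥ q + 3`**: nothing is paid. -/
theorem cap_big {q : ℕ} (w : Finset α → Finset α → ℚ)
    (hw_big : ∀ B S : Finset α, q + 3 ≤ S.card → w B S = 0)
    {S : Finset α} (hSc : q + 3 ≤ S.card) :
    ∑ B ∈ (Profile.Rq M q).filter (fun B => B ⊆ S), w B S ≤ (q : ℚ) + 1 := by
  rw [Finset.sum_eq_zero (fun B _ => hw_big B S hSc)]; positivity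

end ThinTriangle
end PercRepro
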